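import Literature.MathematicalPhysics.KineticTheory.HardSphereMildBBGKYLimit
import HarnessLib

/-!
# Towards the one-step mild BBGKY hierarchy almost everywhere: removing the cut-offs
(Cercignani–Illner–Pulvirenti 1994 §4.3, Thm 4.3.1, App. 4.B; trunk T-KINETIC, topic
MathematicalPhysics/KineticTheory; continuation of `HardSphereMildBBGKYLimit`.)

Pointwise limits behind the removal of the window cut-off in `sum_window_decomposition`:

* `eventually_mem_singleCollisionEvent_of_good` — if the outgoing collision configuration
  `w = lossConfig Z' i ν v` (positive flux) is good, then for all sufficiently short windows
  `δ` and every offset `σ ∈ (0, δ]`, the datum `S_{-σ}(gainConfig Z' i ν v)` belongs to the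
  single-collision event of length `δ`: the orbit of `w` has no contact at the times of
  `(-η, η) ∖ {0}` (forward: free flight of the outgoing configuration; backward: free flight of
  the incoming one), so the orbit description `mem_singleCollisionEvent_iff_orbit` applies.

## References

* C. Cercignani, R. Illner, M. Pulvirenti, *The Mathematical Theory of Dilute Gases*, Springer
  (1994), §4.3, App. 4.B.
-/

open MeasureTheory MeasureTheory.Measure Metric Real Set Filter Function Topology
open scoped ENNReal InnerProductSpace
open Literature.Analysis.FluidPDE Literature.Analysis

namespace Literature.MathematicalPhysics.KineticTheory

noncomputable section

section Kinetic

variable {d : Type*} [Fintype d]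

section Clean

variable {ε : ℝ} (hε : 0 < ε) (hε' : ε < 2⁻¹)

include hε hε' in
/-- **Short windows around an isolated good collision are clean.** Let `w = lossConfig Z' i ν v`
be an outgoing collision configuration with positive flux `⟪v - v_i, ν⟫ > 0` which is good.
Then there is `η > 0` such that for every window length `δ ∈ (0, η)` and every offset
`σ ∈ (0, δ]`, the pre-collisional datum `S_{-σ}(gainConfig Z' i ν v)` belongs to the
single-collision event of the pair (`i`, last) of length `δ`. [cite: CIP1994, App. 4.B] -/
theorem eventually_mem_singleCollisionEvent_of_good {s : ℕ} (i : Fin (s + 1)) (Z' : Config (s + 1) d (UnitAddTorus d))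
    (ν : sphere (0 : EuclideanSpace ℝ d) 1) (v : EuclideanSpace ℝ d)
    (hflux : 0 < ⟪v - (Z' i).2, (ν : EuclideanSpace ℝ d)⟫_ℝ)
    (hgood : lossConfig (Torus.geometry d) ε Z' i ν v ∈ Alexander.good (Torus.geometry d) ε) :
    ∃ η : ℝ, 0 < η ∧ ∀ δ : ℝ, 0 < δ → δ < η → ∀ σ ∈ Ioc (0 : ℝ) δ,
      freeFlight (Torus.geometry d) (-σ) (gainConfig (Torus.geometry d) ε Z' i ν v) ∈
        Alexander.singleCollisionEvent (Torus.geometry d) ε (Fin.castAdd 1 i) (Fin.natAdd (s + 1) 0) δ := by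
  have hG := Torus.isHardSphereRegular_geometry (d := d) hε'
  set G := Torus.geometry d with hGdef
  set I : Fin (s + 1 + 1) := Fin.castAdd 1 i with hI
  set L : Fin (s + 1 + 1) := Fin.natAdd (s + 1) 0 with hL
  set w := lossConfig G ε Z' i ν v with hw
  set win := gainConfig G ε Z' i ν v with hwin
  set y := flipVel w with hy
  have hIL : I ≠ L := by intro h; have := congrArg Fin.val h; simp [hI, hL] at this; omega
  obtain ⟨hwD, hclause, hgoodw, hgoody⟩ := hgood
  -- `w` is an outgoing simple contact configuration of the pair `(I, L)`
  have hsep : G.sepVec (w I).1 (w L).1 = -(ε • (ν : EuclideanSpace ℝ d)) := by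
    rw [hw, hI, hL]; exact sepVec_lossConfig_partner hε hε' Z' i ν v
  have hnorm : ‖G.sepVec (w I).1 (w L).1‖ = ε := by
    rw [hsep, norm_neg, norm_smul, Real.norm_of_nonneg hε.le, norm_eq_of_mem_sphere ν, mul_one]
  have hcontact : w ∈ contactSet G (s + 1 + 1) ε I L := ⟨hwD, hnorm⟩
  have hvelI : (w I).2 = (Z' i).2 := by rw [hw, hI, lossConfig_apply_castAdd]
  have hvelL : (w L).2 = v := by rw [hw, hL, lossConfig_apply_last]
  have hout : IsOutgoing G w I L := by
    show 0 < ⟪G.sepVec (w I).1 (w L).1, (w I).2 - (w L).2⟫_ℝ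
    rw [hsep, hvelI, hvelL, inner_neg_left, real_inner_smul_left]
    have h1 : ⟪(ν : EuclideanSpace ℝ d), (Z' i).2 - v⟫_ℝ = -⟪v - (Z' i).2, (ν : EuclideanSpace ℝ d)⟫_ℝ := by
      rw [show (Z' i).2 - v = -(v - (Z' i).2) by abel, inner_neg_right, real_inner_comm]
    rw [h1, mul_neg, neg_neg]
    exact mul_pos hε hflux
  have hpairs : ∀ i' j' : Fin (s + 1 + 1), i' ≠ j' → (w ∈ contactSet G (s + 1 + 1) ε i' j' ↔ ({i', j'} : Finset _) = {I, L}) := by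
    intro i' j' hij'
    constructor
    · exact (hclause I L hIL hcontact).2 i' j' hij'
    · intro h
      rcases Alexander.finsetPair_eq_iff.1 h with ⟨rfl, rfl⟩ | ⟨rfl, rfl⟩
      · exact hcontact
      · exact hG.mem_contactSet_comm.1 hcontact
  -- the incoming configuration `y = flipVel w` is simple incoming, with exit time `0`
  have hy_simple : Alexander.IsSimpleIncomingWith G ε y (I, L) := by
    refine ⟨?_, (isIncoming_flipVel_iff w I L).2 hout, fun i' j' hij' => ?_⟩
    · show I < L
      rw [Fin.lt_def]; simp [hI, hL]; omega
    · rw [hy, flipVel_mem_contactSet_iff]; exact hpairs i' j' hij'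
  have hy_exit : Alexander.freeExitTime G ε y = 0 :=
    Alexander.freeExitTime_eq_zero_of_isIncoming hG hIL ((flipVel_mem_contactSet_iff w).2 hcontact) hy_simple.2.1
  have hy_t1 : Alexander.collisionInstant G ε y 1 = 0 := by rw [Alexander.collisionInstant_one, hy_exit]
  have hy_state : Alexander.stateAfter G ε y 1 = flipVel win := by
    rw [Alexander.stateAfter_one, Alexander.collisionStep_eq_collidePair (by rw [hy_exit]; exact ENNReal.zero_ne_top) (p := (I, L))
      (by rw [hy_exit, ENNReal.toReal_zero, freeFlight_zero]; exact hy_simple)]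
    rw [hy_exit, ENNReal.toReal_zero, freeFlight_zero, hy, collidePair_flipVel hIL, hw, hwin, hGdef, hI, hL]
    congr 1
    exact outRep_lossConfig_torus hε hε' Z' i ν v
  -- the two free windows
  have hgoodwF : Alexander.FwdGood G ε w := hgoodw
  have hgoodyF : Alexander.FwdGood G ε y := hgoody
  have hη1pos : 0 < Alexander.freeExitTime G ε w := Alexander.freeExitTime_pos_of_mem_good hG ⟨hwD, hclause, hgoodw, hgoody⟩
  have hη2pos : 0 < Alexander.freeExitTime G ε (Alexander.stateAfter G ε y 1) := hgoodyF.freeExitTime_stateAfter_succ_pos hG 0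
  -- a positive real below both windows
  obtain ⟨η, hη0, hη1, hη2⟩ : ∃ η : ℝ, 0 < η ∧ ENNReal.ofReal η ≤ Alexander.freeExitTime G ε w ∧
      ENNReal.ofReal η ≤ Alexander.freeExitTime G ε (Alexander.stateAfter G ε y 1) := by
    set a := Alexander.freeExitTime G ε w
    set b := Alexander.freeExitTime G ε (Alexander.stateAfter G ε y 1)
    have hm : 0 < min (min a b) 1 := lt_min (lt_min hη1pos hη2pos) one_pos
    have hfin : min (min a b) 1 ≠ ∞ := ne_top_of_le_ne_top ENNReal.one_ne_top (min_le_right _ _)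
    refine ⟨(min (min a b) 1).toReal, ENNReal.toReal_pos hm.ne' hfin, ?_, ?_⟩
    · rw [ENNReal.ofReal_toReal hfin]; exact (min_le_left _ _).trans (min_le_left _ _)
    · rw [ENNReal.ofReal_toReal hfin]; exact (min_le_left _ _).trans (min_le_right _ _)
  refine ⟨η, hη0, fun δ hδ hδη σ hσ => ?_⟩
  have hσ0 : 0 < σ := hσ.1
  have hσδ : σ ≤ δ := hσ.2
  have hσlt2 : ENNReal.ofReal σ < Alexander.freeExitTime G ε (Alexander.stateAfter G ε y 1) :=
    lt_of_lt_of_le ((ENNReal.ofReal_lt_ofReal_iff hη0).2 (by linarith)) hη2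
  -- the datum is `Φ_{-σ} w`
  set z := freeFlight G (-σ) win with hz
  have hback : ∀ u : ℝ, 0 < u → ENNReal.ofReal u < Alexander.freeExitTime G ε (Alexander.stateAfter G ε y 1) →
      Alexander.flow G ε (-u) w = freeFlight G (-u) win ∧
      ∀ i' j' : Fin (s + 1 + 1), i' ≠ j' → Alexander.flow G ε (-u) w ∉ contactSet G (s + 1 + 1) ε i' j' := by
    intro u hu hult
    have hleft : Alexander.fwdFlowLeft G ε y u = freeFlight G u (flipVel win) := by
      rw [Alexander.fwdFlowLeft_eq_of_segment (k := 1) (Or.inl (by rw [hy_t1]; exact ENNReal.ofReal_pos.2 hu))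
        (by rw [Alexander.collisionInstant_succ, hy_t1, zero_add]; exact hult.le), hy_t1, ENNReal.toReal_zero, sub_zero, hy_state]
    have hflow : Alexander.flow G ε (-u) w = freeFlight G (-u) win := by
      rw [Alexander.flow_of_neg (neg_neg_of_pos hu), neg_neg, ← hy, hleft, Alexander.flipVel_freeFlight_flipVel]
    refine ⟨hflow, fun i' j' hij' hc => ?_⟩
    -- no grazing inside the free flight of the state after the first collision of `y`
    have hng := hgoodyF.2.1 1 u hu hult i' j' hij'
    rw [hy_state] at hng
    apply hng
    rw [← Alexander.flipVel_freeFlight_flipVel] at hflow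
    have : freeFlight G u (flipVel win) = flipVel (Alexander.flow G ε (-u) w) := by
      rw [hflow, flipVel_flipVel]
    rw [this, flipVel_mem_contactSet_iff]
    exact hc
  have hzflow : Alexander.flow G ε (-σ) w = z := (hback σ hσ0 hσlt2).1
  have hwgood : w ∈ Alexander.good G ε := ⟨hwD, hclause, hgoodw, hgoody⟩
  have hzgood : z ∈ Alexander.good G ε := hzflow ▸ Alexander.mapsTo_flow_good hG (-σ) hwgood
  -- the orbit of `z` is that of `w`, shifted
  have horbit : ∀ u : ℝ, 0 ≤ u → Alexander.fwdFlow G ε z u = Alexander.flow G ε (u - σ) w := by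
    intro u hu
    rw [← Alexander.flow_of_nonneg hu, ← hzflow, ← Alexander.flow_add_of_mem_good hG u (-σ) hwgood, ← sub_eq_add_neg]
  -- forward: free flight of `w` without contact
  have hfwd : ∀ u : ℝ, 0 < u → u < η → ∀ i' j' : Fin (s + 1 + 1), i' ≠ j' → Alexander.flow G ε u w ∉ contactSet G (s + 1 + 1) ε i' j' := by
    intro u hu huη i' j' hij'
    have hult : ENNReal.ofReal u < Alexander.freeExitTime G ε w := lt_of_lt_of_le ((ENNReal.ofReal_lt_ofReal_iff hη0).2 huη) hη1
    rw [Alexander.flow_of_nonneg hu.le, Alexander.fwdFlow_eq_freeFlight_of_lt hult]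
    have hng := hgoodwF.2.1 0 u hu (by rwa [Alexander.stateAfter_zero]) i' j' hij'
    rwa [Alexander.stateAfter_zero] at hng
  -- apply the orbit description
  rw [Alexander.mem_singleCollisionEvent_iff_orbit hG hIL hδ]
  refine ⟨hzgood, ⟨σ, hσ, ?_⟩, fun τ₁ hτ₁ τ₂ hτ₂ h₁ h₂ => ?_⟩
  · rw [horbit σ hσ0.le, sub_self, Alexander.flow_zero_of_mem_good hG hwgood]
    exact hcontact
  · -- every contact time of the window is `σ`
    have huniq : ∀ τ ∈ Ioc (0 : ℝ) δ, (∃ i' j' : Fin (s + 1 + 1), i' ≠ j' ∧ Alexander.fwdFlow G ε z τ ∈ contactSet G (s + 1 + 1) ε i' j') → τ = σ := by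
      rintro τ hτ ⟨i', j', hij', hc⟩
      rw [horbit τ hτ.1.le] at hc
      by_contra hne
      rcases lt_or_gt_of_ne hne with hlt | hgt
      · -- before the collision: backward free flight of the incoming configuration
        have hu : 0 < σ - τ := sub_pos.2 hlt
        have hult : ENNReal.ofReal (σ - τ) < Alexander.freeExitTime G ε (Alexander.stateAfter G ε y 1) :=
          lt_of_le_of_lt (ENNReal.ofReal_le_ofReal (by linarith [hτ.1])) hσlt2
        have h := (hback (σ - τ) hu hult).2 i' j' hij'
        rw [show -(σ - τ) = τ - σ by ring] at h
        exact h hc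
      · -- after the collision: forward free flight of the outgoing configuration
        have hu : 0 < τ - σ := sub_pos.2 hgt
        exact hfwd (τ - σ) hu (by linarith [hτ.2]) i' j' hij' hc
    rw [huniq τ₁ hτ₁ h₁, huniq τ₂ hτ₂ h₂]

end Clean

section Dirty

variable {X : Type*} {N : ℕ} {G : Geometry d X} {ε : ℝ} [TopologicalSpace X]

omit [TopologicalSpace X] in
/-- **Dirty windows carry at least one new instant each**: for a forward-good orbit and windows
`(jδ, (j+1)δ]`, `j < M`, the number of dirty windows (at least two instants) is at most the
number of instants in `(0, Mδ]`. [folklore] -/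
theorem sum_indicator_dirty_le {y : Config N d X} (hgood : Alexander.FwdGood G ε y) {δ : ℝ} (hδ : 0 ≤ δ) (M : ℕ) :
    ∑ j ∈ Finset.range M, ({y : Config N d X | Alexander.collisionCount G ε y (j * δ) + 2 ≤ Alexander.collisionCount G ε y (j * δ + δ)}).indicator
        (1 : Config N d X → ℝ) y ≤ (Alexander.collisionCount G ε y (M * δ) : ℝ) := by
  have hmono : ∀ {a b : ℝ}, a ≤ b → Alexander.collisionCount G ε y a ≤ Alexander.collisionCount G ε y b := by
    intro a b hab
    rw [Alexander.le_collisionCount_iff hgood]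
    exact (Alexander.collisionCount_spec hgood a).1.trans (ENNReal.ofReal_le_ofReal hab)
  have hstep : ∀ j : ℕ, ({y : Config N d X | Alexander.collisionCount G ε y (j * δ) + 2 ≤ Alexander.collisionCount G ε y (j * δ + δ)}).indicator
      (1 : Config N d X → ℝ) y ≤ (Alexander.collisionCount G ε y (j * δ + δ) : ℝ) - Alexander.collisionCount G ε y (j * δ) := by
    intro j
    have hle : (Alexander.collisionCount G ε y (j * δ) : ℝ) ≤ Alexander.collisionCount G ε y (j * δ + δ) := by
      exact_mod_cast hmono (by linarith)
    by_cases h : y ∈ {y : Config N d X | Alexander.collisionCount G ε y (j * δ) + 2 ≤ Alexander.collisionCount G ε y (j * δ + δ)}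
    · rw [indicator_of_mem h, Pi.one_apply]
      have h' : (Alexander.collisionCount G ε y (j * δ) : ℝ) + 2 ≤ Alexander.collisionCount G ε y (j * δ + δ) := by exact_mod_cast h
      linarith
    · rw [indicator_of_notMem h]; linarith
  have htel : ∀ M : ℕ, ∑ j ∈ Finset.range M, ((Alexander.collisionCount G ε y (j * δ + δ) : ℝ) - Alexander.collisionCount G ε y (j * δ)) =
      (Alexander.collisionCount G ε y (M * δ) : ℝ) - Alexander.collisionCount G ε y 0 := by
    intro M
    induction M with
    | zero => simp
    | succ M ih =>
      rw [Finset.sum_range_succ, ih, Nat.cast_succ, add_mul, one_mul]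
      ring
  calc ∑ j ∈ Finset.range M, _ ≤ ∑ j ∈ Finset.range M, ((Alexander.collisionCount G ε y (j * δ + δ) : ℝ) - Alexander.collisionCount G ε y (j * δ)) :=
        Finset.sum_le_sum fun j _ => hstep j
    _ = (Alexander.collisionCount G ε y (M * δ) : ℝ) - Alexander.collisionCount G ε y 0 := htel M
    _ ≤ (Alexander.collisionCount G ε y (M * δ) : ℝ) := by
        have : (0 : ℝ) ≤ Alexander.collisionCount G ε y 0 := Nat.cast_nonneg _
        linarith

/-- **Short windows of a forward-good orbit are not dirty**: there is `η > 0` such that no window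
`(a, a + δ]` with `0 ≤ a`, `a + δ ≤ T` and `0 < δ < η` contains two collision instants (the
instants up to time `T` are finitely many and strictly increasing). [folklore] -/
theorem exists_window_not_dirty [T2Space X] (hG : G.IsHardSphereRegular ε) {y : Config N d X} (hgood : Alexander.FwdGood G ε y) (T : ℝ) :
    ∃ η : ℝ, 0 < η ∧ ∀ a δ : ℝ, 0 ≤ a → 0 < δ → δ < η → a + δ ≤ T →
      ¬ (Alexander.collisionCount G ε y a + 2 ≤ Alexander.collisionCount G ε y (a + δ)) := by
  classical
  set K := Alexander.collisionCount G ε y T with hK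
  -- the gaps between consecutive instants up to time `T`
  have hgap : ∀ k : ℕ, 1 ≤ k → k + 1 ≤ K → 0 < (Alexander.collisionInstant G ε y (k + 1)).toReal - (Alexander.collisionInstant G ε y k).toReal := by
    intro k hk1 hkK
    have hfin1 : Alexander.collisionInstant G ε y (k + 1) ≠ ∞ :=
      ne_top_of_le_ne_top ENNReal.ofReal_ne_top ((Alexander.le_collisionCount_iff hgood).1 hkK)
    have hfin : Alexander.collisionInstant G ε y k ≠ ∞ :=
      ne_top_of_le_ne_top hfin1 (Alexander.monotone_collisionInstant y (Nat.le_succ k))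
    have hlt := hgood.collisionInstant_lt_succ hG (Nat.pos_of_ne_zero (by omega)) hfin
    exact sub_pos.2 ((ENNReal.toReal_lt_toReal hfin hfin1).2 hlt)
  -- a positive `η` below all gaps
  obtain ⟨η, hη0, hηgap⟩ : ∃ η : ℝ, 0 < η ∧ ∀ k : ℕ, 1 ≤ k → k + 1 ≤ K →
      η ≤ (Alexander.collisionInstant G ε y (k + 1)).toReal - (Alexander.collisionInstant G ε y k).toReal := by
    by_cases hK1 : K ≤ 1
    · exact ⟨1, one_pos, fun k hk hkK => by omega⟩
    · push Not at hK1
      set S : Finset ℕ := Finset.Icc 1 (K - 1) with hS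
      have hSne : S.Nonempty := ⟨1, by simp [hS]; omega⟩
      set η := S.inf' hSne (fun k => (Alexander.collisionInstant G ε y (k + 1)).toReal - (Alexander.collisionInstant G ε y k).toReal) with hη
      refine ⟨η, ?_, fun k hk hkK => ?_⟩
      · rw [hη, Finset.lt_inf'_iff]
        intro k hk
        simp only [hS, Finset.mem_Icc] at hk
        exact hgap k hk.1 (by omega)
      · rw [hη]
        exact Finset.inf'_le _ (by simp [hS]; omega)
  refine ⟨η, hη0, fun a δ ha hδ hδη haT hdirty => ?_⟩
  set c := Alexander.collisionCount G ε y a with hc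
  -- the instants `t_{c+1} < t_{c+2}` both lie in `(a, a + δ]`
  have h1 : ENNReal.ofReal a < Alexander.collisionInstant G ε y (c + 1) := (Alexander.collisionCount_spec hgood a).2
  have h2 : Alexander.collisionInstant G ε y (c + 2) ≤ ENNReal.ofReal (a + δ) := (Alexander.le_collisionCount_iff hgood).1 hdirty
  have hcK : c + 2 ≤ K := by
    rw [hK, Alexander.le_collisionCount_iff hgood]
    exact h2.trans (ENNReal.ofReal_le_ofReal haT)
  have hfin2 : Alexander.collisionInstant G ε y (c + 2) ≠ ∞ := ne_top_of_le_ne_top ENNReal.ofReal_ne_top h2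
  have hfin1 : Alexander.collisionInstant G ε y (c + 1) ≠ ∞ :=
    ne_top_of_le_ne_top hfin2 (Alexander.monotone_collisionInstant y (Nat.le_succ _))
  have hgapc := hηgap (c + 1) (by omega) (by omega)
  have ht1 : a < (Alexander.collisionInstant G ε y (c + 1)).toReal := by
    have := (ENNReal.ofReal_lt_iff_lt_toReal ha hfin1).1 h1
    exact this
  have ht2 : (Alexander.collisionInstant G ε y (c + 2)).toReal ≤ a + δ := by
    have := ENNReal.toReal_mono ENNReal.ofReal_ne_top h2
    rwa [ENNReal.toReal_ofReal (by linarith)] at this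
  have : (Alexander.collisionInstant G ε y (c + 1 + 1)).toReal = (Alexander.collisionInstant G ε y (c + 2)).toReal := rfl
  rw [this] at hgapc
  linarith

end Dirty

section FluxWindows

variable {ε : ℝ} (hε : 0 < ε) (hε' : ε < 2⁻¹)

set_option maxHeartbeats 1000000 in
include hε hε' in
/-- **The flux integrals of the windows over the absolute collision time** (Step 3 of
`sum_window_decomposition` for a general integrand): for a jointly measurable `K` on
(time) × (configurations) whose window pull-backs to the single-collision event are integrable,
the sum over the windows `j < N` of the collision-coordinate integrals of
`flux · 1_{slow} · 1_E(S_{-τ} gain) · K(jδ + τ, loss)` over `τ ∈ (0, δ]` is the integral over the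
absolute collision time `τ' ∈ (0, Nδ]` of `flux · 1_{slow} · 1_E(S_{-(τ' - δ(⌈τ'/δ⌉-1))} gain) · K(τ', loss)`,
an integrable function (`integral_singleCollisionEvent_eq`, `integral_comp_timeShift`,
`sum_integral_timeWindows`). [cite: CIP1994, App. 4.B] -/
theorem flux_windows_sum [Nonempty d] {k m' : ℕ} [NeZero k] (i : Fin k) {δ V ρ : ℝ} (hδ : 0 < δ) (N : ℕ)
    (hρ : ρ < 1 / 2) (hδV : ε + δ * V ≤ ρ)
    (K : ℝ → Config (k + (m' + 1)) d (UnitAddTorus d) → ℝ) (hKm : Measurable fun q : ℝ × Config (k + (m' + 1)) d (UnitAddTorus d) => K q.1 q.2)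
    (hKi : ∀ j : ℕ, j < N → Integrable (fun z : Config (k + m' + 1) d (UnitAddTorus d) =>
      (Alexander.singleCollisionEvent (Torus.geometry d) ε (Fin.castAdd 1 (Fin.castAdd m' i)) (Fin.natAdd (k + m') 0) δ).indicator
        (fun z => {z : Config (k + m' + 1) d (UnitAddTorus d) |
            ‖(z (Fin.natAdd (k + m') 0)).2 - (z (Fin.castAdd 1 (Fin.castAdd m' i))).2‖ ≤ V}.indicator
          (fun z => K (j * δ + (Alexander.collisionInstant (Torus.geometry d) ε z 1).toReal)
            (outRep (Torus.geometry d) (k + m') (Fin.castAdd m' i)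
              (freeFlight (Torus.geometry d) (Alexander.collisionInstant (Torus.geometry d) ε z 1).toReal z))) z) z)) :
    Integrable (fun p : (Config (k + m') d (UnitAddTorus d) × EuclideanSpace ℝ d) × (sphere (0 : EuclideanSpace ℝ d) 1 × ℝ) => ε ^ (Fintype.card d - 1) * max ⟪p.1.2 - (p.1.1 (Fin.castAdd m' i)).2, (p.2.1 : EuclideanSpace ℝ d)⟫_ℝ 0 *
          {v : EuclideanSpace ℝ d | ‖v - (p.1.1 (Fin.castAdd m' i)).2‖ ≤ V}.indicator (1 : EuclideanSpace ℝ d → ℝ) p.1.2 *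
          (Alexander.singleCollisionEvent (Torus.geometry d) ε (Fin.castAdd 1 (Fin.castAdd m' i)) (Fin.natAdd (k + m') 0) δ).indicator
            (1 : Config (k + m' + 1) d (UnitAddTorus d) → ℝ)
            (freeFlight (Torus.geometry d) (-(p.2.2 - (δ * ((⌈p.2.2 / δ⌉ : ℤ) - 1 : ℝ)))) (gainConfig (Torus.geometry d) ε p.1.1 (Fin.castAdd m' i) p.2.1 p.1.2)) *
          K p.2.2 (lossConfig (Torus.geometry d) ε p.1.1 (Fin.castAdd m' i) p.2.1 p.1.2)) ((((volume : Measure (Config (k + m') d (UnitAddTorus d))).prod (volume : Measure (EuclideanSpace ℝ d))).prod ((((volume : Measure (EuclideanSpace ℝ d)).toSphere).prod ((volume : Measure ℝ).restrict (Ioc 0 (N * δ))))))) ∧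
    ∑ j ∈ Finset.range N, ∫ p, ε ^ (Fintype.card d - 1) * max ⟪p.1.2 - (p.1.1 (Fin.castAdd m' i)).2, (p.2.1 : EuclideanSpace ℝ d)⟫_ℝ 0 *
          {v : EuclideanSpace ℝ d | ‖v - (p.1.1 (Fin.castAdd m' i)).2‖ ≤ V}.indicator (1 : EuclideanSpace ℝ d → ℝ) p.1.2 *
          (Alexander.singleCollisionEvent (Torus.geometry d) ε (Fin.castAdd 1 (Fin.castAdd m' i)) (Fin.natAdd (k + m') 0) δ).indicator
            (1 : Config (k + m' + 1) d (UnitAddTorus d) → ℝ)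
            (freeFlight (Torus.geometry d) (-p.2.2) (gainConfig (Torus.geometry d) ε p.1.1 (Fin.castAdd m' i) p.2.1 p.1.2)) *
          K (j * δ + p.2.2) (lossConfig (Torus.geometry d) ε p.1.1 (Fin.castAdd m' i) p.2.1 p.1.2) ∂((((volume : Measure (Config (k + m') d (UnitAddTorus d))).prod (volume : Measure (EuclideanSpace ℝ d))).prod ((((volume : Measure (EuclideanSpace ℝ d)).toSphere).prod ((volume : Measure ℝ).restrict (Ioc 0 δ)))))) = ∫ p, ε ^ (Fintype.card d - 1) * max ⟪p.1.2 - (p.1.1 (Fin.castAdd m' i)).2, (p.2.1 : EuclideanSpace ℝ d)⟫_ℝ 0 *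
          {v : EuclideanSpace ℝ d | ‖v - (p.1.1 (Fin.castAdd m' i)).2‖ ≤ V}.indicator (1 : EuclideanSpace ℝ d → ℝ) p.1.2 *
          (Alexander.singleCollisionEvent (Torus.geometry d) ε (Fin.castAdd 1 (Fin.castAdd m' i)) (Fin.natAdd (k + m') 0) δ).indicator
            (1 : Config (k + m' + 1) d (UnitAddTorus d) → ℝ)
            (freeFlight (Torus.geometry d) (-(p.2.2 - (δ * ((⌈p.2.2 / δ⌉ : ℤ) - 1 : ℝ)))) (gainConfig (Torus.geometry d) ε p.1.1 (Fin.castAdd m' i) p.2.1 p.1.2)) *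
          K p.2.2 (lossConfig (Torus.geometry d) ε p.1.1 (Fin.castAdd m' i) p.2.1 p.1.2) ∂((((volume : Measure (Config (k + m') d (UnitAddTorus d))).prod (volume : Measure (EuclideanSpace ℝ d))).prod ((((volume : Measure (EuclideanSpace ℝ d)).toSphere).prod ((volume : Measure ℝ).restrict (Ioc 0 (N * δ))))))) := by
  classical
  haveI hXE : SigmaFinite (volume : Measure (UnitAddTorus d × EuclideanSpace ℝ d)) := inferInstance
  haveI hC : SigmaFinite (volume : Measure (Config (k + m') d (UnitAddTorus d))) := inferInstance
  haveI hσf : IsFiniteMeasure ((volume : Measure (EuclideanSpace ℝ d)).toSphere) := inferInstance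
  haveI : NeZero (k + m') := ⟨by have := NeZero.ne k; omega⟩
  set μ : Set ℝ → Measure ((Config (k + m') d (UnitAddTorus d) × EuclideanSpace ℝ d) × (sphere (0 : EuclideanSpace ℝ d) 1 × ℝ)) := fun S =>
    (((volume : Measure (Config (k + m') d (UnitAddTorus d))).prod (volume : Measure (EuclideanSpace ℝ d))).prod
      ((((volume : Measure (EuclideanSpace ℝ d)).toSphere).prod ((volume : Measure ℝ).restrict S)))) with hμ
  set g : ℕ → (Config (k + m') d (UnitAddTorus d) × EuclideanSpace ℝ d) × (sphere (0 : EuclideanSpace ℝ d) 1 × ℝ) → ℝ := fun j p => ε ^ (Fintype.card d - 1) * max ⟪p.1.2 - (p.1.1 (Fin.castAdd m' i)).2, (p.2.1 : EuclideanSpace ℝ d)⟫_ℝ 0 *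
          {v : EuclideanSpace ℝ d | ‖v - (p.1.1 (Fin.castAdd m' i)).2‖ ≤ V}.indicator (1 : EuclideanSpace ℝ d → ℝ) p.1.2 *
          (Alexander.singleCollisionEvent (Torus.geometry d) ε (Fin.castAdd 1 (Fin.castAdd m' i)) (Fin.natAdd (k + m') 0) δ).indicator
            (1 : Config (k + m' + 1) d (UnitAddTorus d) → ℝ)
            (freeFlight (Torus.geometry d) (-p.2.2) (gainConfig (Torus.geometry d) ε p.1.1 (Fin.castAdd m' i) p.2.1 p.1.2)) *
          K (j * δ + p.2.2) (lossConfig (Torus.geometry d) ε p.1.1 (Fin.castAdd m' i) p.2.1 p.1.2) with hg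
  set G : (Config (k + m') d (UnitAddTorus d) × EuclideanSpace ℝ d) × (sphere (0 : EuclideanSpace ℝ d) 1 × ℝ) → ℝ := fun p => ε ^ (Fintype.card d - 1) * max ⟪p.1.2 - (p.1.1 (Fin.castAdd m' i)).2, (p.2.1 : EuclideanSpace ℝ d)⟫_ℝ 0 *
          {v : EuclideanSpace ℝ d | ‖v - (p.1.1 (Fin.castAdd m' i)).2‖ ≤ V}.indicator (1 : EuclideanSpace ℝ d → ℝ) p.1.2 *
          (Alexander.singleCollisionEvent (Torus.geometry d) ε (Fin.castAdd 1 (Fin.castAdd m' i)) (Fin.natAdd (k + m') 0) δ).indicator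
            (1 : Config (k + m' + 1) d (UnitAddTorus d) → ℝ)
            (freeFlight (Torus.geometry d) (-(p.2.2 - (δ * ((⌈p.2.2 / δ⌉ : ℤ) - 1 : ℝ)))) (gainConfig (Torus.geometry d) ε p.1.1 (Fin.castAdd m' i) p.2.1 p.1.2)) *
          K p.2.2 (lossConfig (Torus.geometry d) ε p.1.1 (Fin.castAdd m' i) p.2.1 p.1.2) with hGdef
  show Integrable G (μ (Ioc 0 (N * δ))) ∧ ∑ j ∈ Finset.range N, ∫ p, g j p ∂μ (Ioc 0 δ) = ∫ p, G p ∂μ (Ioc 0 (N * δ))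
  have hae0 : ∀ᵐ p ∂μ (Ioc 0 δ), p.2.2 ∈ Ioc (0 : ℝ) δ := by
    have hnull : μ (Ioc 0 δ) {p : (Config (k + m') d (UnitAddTorus d) × EuclideanSpace ℝ d) × (sphere (0 : EuclideanSpace ℝ d) 1 × ℝ) | p.2.2 ∉ Ioc (0 : ℝ) δ} = 0 := by
      have hset : {p : (Config (k + m') d (UnitAddTorus d) × EuclideanSpace ℝ d) × (sphere (0 : EuclideanSpace ℝ d) 1 × ℝ) | p.2.2 ∉ Ioc (0 : ℝ) δ} =
          (Set.univ : Set (Config (k + m') d (UnitAddTorus d) × EuclideanSpace ℝ d)) ×ˢ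
            ((Set.univ : Set (sphere (0 : EuclideanSpace ℝ d) 1)) ×ˢ (Ioc (0 : ℝ) δ)ᶜ) := by
        ext p; simp
      simp only [hμ]
      rw [hset, Measure.prod_prod, Measure.prod_prod, Measure.restrict_apply (measurableSet_Ioc.compl), Set.compl_inter_self,
        measure_empty, mul_zero, mul_zero]
    rw [ae_iff]
    simpa using hnull
  have hceil : ∀ (j : ℕ) (τ : ℝ), τ ∈ Ioc (0 : ℝ) δ → (⌈(τ + j * δ) / δ⌉ : ℤ) = (j : ℤ) + 1 := by
    intro j τ hτ
    rw [Int.ceil_eq_iff]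
    push_cast
    constructor
    · rw [add_sub_cancel_right, lt_div_iff₀ hδ]; linarith [hτ.1]
    · rw [div_le_iff₀ hδ]; linarith [hτ.2]
  have hGeq : ∀ (j : ℕ) (p : (Config (k + m') d (UnitAddTorus d) × EuclideanSpace ℝ d) × (sphere (0 : EuclideanSpace ℝ d) 1 × ℝ)), p.2.2 ∈ Ioc (0 : ℝ) δ → g j p = G (p.1, (p.2.1, p.2.2 + j * δ)) := by
    intro j p hp
    have hc := hceil j p.2.2 hp
    simp only [hg, hGdef]
    rw [hc]
    have ht : -(p.2.2 + (j : ℝ) * δ - δ * ((((j : ℤ) + 1 : ℤ) : ℝ) - 1)) = -p.2.2 := by push_cast; ring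
    rw [ht, add_comm p.2.2 ((j : ℝ) * δ)]
  have hHm : ∀ j : ℕ, Measurable fun q : ℝ × Config (k + (m' + 1)) d (UnitAddTorus d) => K (j * δ + q.1) q.2 := fun j =>
    hKm.comp ((measurable_const.add measurable_fst).prodMk measurable_snd)
  have hgi : ∀ j : ℕ, j < N → Integrable (g j) (μ (Ioc 0 δ)) := by
    intro j hj
    have h := (integral_singleCollisionEvent_eq hε hε' (Fin.castAdd m' i) hρ hδV (fun τ w => K (j * δ + τ) w) (hHm j) (hKi j hj)).1
    simpa only [hg, hμ] using h
  have hGi : ∀ j : ℕ, j < N → Integrable G (μ (Ioc (j * δ) (j * δ + δ))) := by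
    intro j hj
    have hcomp : Integrable (G ∘ (fun p : (Config (k + m') d (UnitAddTorus d) × EuclideanSpace ℝ d) × (sphere (0 : EuclideanSpace ℝ d) 1 × ℝ) => (p.1, (p.2.1, p.2.2 + j * δ)))) (μ (Ioc 0 δ)) :=
      (hgi j hj).congr (hae0.mono fun p hp => hGeq j p hp)
    have h := ((measurePreserving_timeShift (n := k + m') (d := d) (j * δ) δ).integrable_comp_emb (measurableEmbedding_timeShift _)).1 hcomp
    simpa only [hμ] using h
  have hFluxj : ∀ j : ℕ, j < N → ∫ p, g j p ∂μ (Ioc 0 δ) = ∫ p, G p ∂μ (Ioc (j * δ) (j * δ + δ)) := by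
    intro j hj
    have h := integral_comp_timeShift (n := k + m') (d := d) (j * δ) δ G
    rw [show (∫ p, G p ∂μ (Ioc (j * δ) (j * δ + δ))) = ∫ p, G (p.1, (p.2.1, p.2.2 + j * δ)) ∂μ (Ioc 0 δ) from by
      simp only [hμ]; exact h.symm]
    exact integral_congr_ae (hae0.mono fun p hp => hGeq j p hp)
  have hsw := sum_integral_timeWindows (n := k + m') (d := d) hδ.le N G (fun j hj => by
    have := hGi j hj
    rw [show (j : ℝ) * δ + δ = (j + 1) * δ by ring] at this
    simpa only [hμ] using this)
  refine ⟨by simpa only [hμ] using hsw.1, ?_⟩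
  have h2 := hsw.2
  simp only [hμ] at h2 ⊢
  rw [← h2]
  refine Finset.sum_congr rfl fun j hj => ?_
  rw [hFluxj j (Finset.mem_range.1 hj), show ((j : ℝ) + 1) * δ = j * δ + δ by ring]

end FluxWindows


section Fast

variable {ε : ℝ} (hε : 0 < ε) (hε' : ε < 2⁻¹)

include hε' in
/-- **A window with a single-collision event carries a collision instant**: if `Φ_a z₀` belongs to
a single-collision event of length `δ`, then `collisionCount z₀ (a + δ) ≥ collisionCount z₀ a + 1`
(restart identities). [folklore] -/
theorem collisionCount_succ_le_of_mem_event {N : ℕ} {I L : Fin N} (hIL : I ≠ L) {z₀ : Config N d (UnitAddTorus d)}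
    (hz₀ : z₀ ∈ Alexander.good (Torus.geometry d) ε) {a δ : ℝ} (ha : 0 ≤ a)
    (hmem : Alexander.regFlow (Torus.geometry d) ε a z₀ ∈ Alexander.singleCollisionEvent (Torus.geometry d) ε I L δ) :
    Alexander.collisionCount (Torus.geometry d) ε z₀ a + 1 ≤ Alexander.collisionCount (Torus.geometry d) ε z₀ (a + δ) := by
  have hG := Torus.isHardSphereRegular_geometry (d := d) hε'
  have hgood : Alexander.FwdGood (Torus.geometry d) ε z₀ := hz₀.2.2.1
  rw [Alexander.regFlow_of_mem hz₀, Alexander.flow_of_nonneg ha] at hmem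
  obtain ⟨hτpos, hτle, -, -, -⟩ := Alexander.singleCollisionEvent_structure hG hIL hmem
  obtain ⟨-, h1z, -, -⟩ := hmem
  set c := Alexander.collisionCount (Torus.geometry d) ε z₀ a with hc
  obtain ⟨h1, h2⟩ := Alexander.collisionCount_spec hgood a
  have hr := Alexander.collisionInstant_fwdFlow_succ_add ha h1 h2 0
  simp only [zero_add] at hr
  rw [Alexander.le_collisionCount_iff hgood, ← hr]
  calc Alexander.collisionInstant (Torus.geometry d) ε (Alexander.fwdFlow (Torus.geometry d) ε z₀ a) 1 + ENNReal.ofReal a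
      ≤ ENNReal.ofReal δ + ENNReal.ofReal a := by gcongr
    _ = ENNReal.ofReal (a + δ) := by rw [add_comm, ENNReal.ofReal_add ha (hτpos.le.trans hτle)]

include hε' in
/-- **The fast windows are few and need much energy**: for a good datum with at most `M`
collision instants up to time `Nδ`, the number of windows `(jδ, (j+1)δ]`, `j < N`, starting in a
single-collision event of the pair `(I, L)` with relative speed `> V` is at most `M`, and is `0`
unless `2√(2 E(z₀)) > V` (energy is conserved and bounds every velocity). [folklore] -/
theorem sum_indicator_fast_le {N₀ : ℕ} {I L : Fin N₀} (hIL : I ≠ L) {z₀ : Config N₀ d (UnitAddTorus d)}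
    (hz₀ : z₀ ∈ Alexander.good (Torus.geometry d) ε) {δ : ℝ} (hδ : 0 ≤ δ) (N : ℕ) {M : ℕ}
    (hM : Alexander.collisionCount (Torus.geometry d) ε z₀ (N * δ) ≤ M) (V : ℝ) :
    ∑ j ∈ Finset.range N, (Alexander.singleCollisionEvent (Torus.geometry d) ε I L δ).indicator (1 : Config N₀ d (UnitAddTorus d) → ℝ)
        (Alexander.regFlow (Torus.geometry d) ε (j * δ) z₀) *
      {z : Config N₀ d (UnitAddTorus d) | V < ‖(z L).2 - (z I).2‖}.indicator (1 : Config N₀ d (UnitAddTorus d) → ℝ)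
        (Alexander.regFlow (Torus.geometry d) ε (j * δ) z₀) ≤
      (M : ℝ) * {z : Config N₀ d (UnitAddTorus d) | V < 2 * Real.sqrt (2 * configEnergy z)}.indicator (1 : Config N₀ d (UnitAddTorus d) → ℝ) z₀ := by
  have hgood : Alexander.FwdGood (Torus.geometry d) ε z₀ := hz₀.2.2.1
  by_cases hV : V < 2 * Real.sqrt (2 * configEnergy z₀)
  · rw [indicator_of_mem (show z₀ ∈ {z : Config N₀ d (UnitAddTorus d) | V < 2 * Real.sqrt (2 * configEnergy z)} from hV), Pi.one_apply, mul_one]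
    -- each window with an event carries an instant
    have hstep : ∀ j : ℕ, (Alexander.singleCollisionEvent (Torus.geometry d) ε I L δ).indicator (1 : Config N₀ d (UnitAddTorus d) → ℝ)
        (Alexander.regFlow (Torus.geometry d) ε (j * δ) z₀) *
        {z : Config N₀ d (UnitAddTorus d) | V < ‖(z L).2 - (z I).2‖}.indicator (1 : Config N₀ d (UnitAddTorus d) → ℝ)
          (Alexander.regFlow (Torus.geometry d) ε (j * δ) z₀) ≤
        (Alexander.collisionCount (Torus.geometry d) ε z₀ (j * δ + δ) : ℝ) - Alexander.collisionCount (Torus.geometry d) ε z₀ (j * δ) := by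
      intro j
      have hmono : (Alexander.collisionCount (Torus.geometry d) ε z₀ (j * δ) : ℝ) ≤ Alexander.collisionCount (Torus.geometry d) ε z₀ (j * δ + δ) := by
        have : Alexander.collisionCount (Torus.geometry d) ε z₀ (j * δ) ≤ Alexander.collisionCount (Torus.geometry d) ε z₀ (j * δ + δ) := by
          rw [Alexander.le_collisionCount_iff hgood]
          exact (Alexander.collisionCount_spec hgood _).1.trans (ENNReal.ofReal_le_ofReal (by linarith))
        exact_mod_cast this
      by_cases hmem : Alexander.regFlow (Torus.geometry d) ε (j * δ) z₀ ∈ Alexander.singleCollisionEvent (Torus.geometry d) ε I L δ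
      · rw [indicator_of_mem hmem, Pi.one_apply, one_mul]
        have hc := collisionCount_succ_le_of_mem_event hε' hIL hz₀ (by positivity) hmem
        have hc' : (Alexander.collisionCount (Torus.geometry d) ε z₀ (j * δ) : ℝ) + 1 ≤ Alexander.collisionCount (Torus.geometry d) ε z₀ (j * δ + δ) := by
          exact_mod_cast hc
        have h01 : {z : Config N₀ d (UnitAddTorus d) | V < ‖(z L).2 - (z I).2‖}.indicator (1 : Config N₀ d (UnitAddTorus d) → ℝ)
            (Alexander.regFlow (Torus.geometry d) ε (j * δ) z₀) ≤ 1 := by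
          by_cases h : Alexander.regFlow (Torus.geometry d) ε (j * δ) z₀ ∈ {z : Config N₀ d (UnitAddTorus d) | V < ‖(z L).2 - (z I).2‖}
          · rw [indicator_of_mem h, Pi.one_apply]
          · rw [indicator_of_notMem h]; exact zero_le_one
        linarith
      · rw [indicator_of_notMem hmem, zero_mul]; linarith
    have htel : ∀ M' : ℕ, ∑ j ∈ Finset.range M', ((Alexander.collisionCount (Torus.geometry d) ε z₀ (j * δ + δ) : ℝ) -
        Alexander.collisionCount (Torus.geometry d) ε z₀ (j * δ)) =
        (Alexander.collisionCount (Torus.geometry d) ε z₀ (M' * δ) : ℝ) - Alexander.collisionCount (Torus.geometry d) ε z₀ 0 := by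
      intro M'
      induction M' with
      | zero => simp
      | succ M' ih =>
        rw [Finset.sum_range_succ, ih, Nat.cast_succ, add_mul, one_mul]
        ring
    calc _ ≤ ∑ j ∈ Finset.range N, ((Alexander.collisionCount (Torus.geometry d) ε z₀ (j * δ + δ) : ℝ) - Alexander.collisionCount (Torus.geometry d) ε z₀ (j * δ)) :=
          Finset.sum_le_sum fun j _ => hstep j
      _ = (Alexander.collisionCount (Torus.geometry d) ε z₀ (N * δ) : ℝ) - Alexander.collisionCount (Torus.geometry d) ε z₀ 0 := htel N
      _ ≤ (M : ℝ) := by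
          have h0 : (0 : ℝ) ≤ Alexander.collisionCount (Torus.geometry d) ε z₀ 0 := Nat.cast_nonneg _
          have hM' : (Alexander.collisionCount (Torus.geometry d) ε z₀ (N * δ) : ℝ) ≤ M := by exact_mod_cast hM
          linarith
  · -- not enough energy for a fast pair
    rw [indicator_of_notMem (show z₀ ∉ {z : Config N₀ d (UnitAddTorus d) | V < 2 * Real.sqrt (2 * configEnergy z)} from hV), mul_zero]
    refine Finset.sum_nonpos fun j _ => ?_
    have hslow : Alexander.regFlow (Torus.geometry d) ε (j * δ) z₀ ∉ {z : Config N₀ d (UnitAddTorus d) | V < ‖(z L).2 - (z I).2‖} := by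
      intro h
      have h' : V < ‖(Alexander.regFlow (Torus.geometry d) ε (j * δ) z₀ L).2 - (Alexander.regFlow (Torus.geometry d) ε (j * δ) z₀ I).2‖ := h
      have hL := norm_vel_le_sqrt_configEnergy (Alexander.regFlow (Torus.geometry d) ε (j * δ) z₀) L
      have hI := norm_vel_le_sqrt_configEnergy (Alexander.regFlow (Torus.geometry d) ε (j * δ) z₀) I
      rw [Alexander.configEnergy_regFlow] at hL hI
      have := norm_sub_le (Alexander.regFlow (Torus.geometry d) ε (j * δ) z₀ L).2 (Alexander.regFlow (Torus.geometry d) ε (j * δ) z₀ I).2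
      exact hV (by linarith)
    rw [indicator_of_notMem hslow, mul_zero]

include hε hε' in
/-- **The fast error of a window in the coordinates of the datum** (Liouville):
`∫ 1_E(z) 1_{fast}(z) |W(Φ_{-a} z)| dz = ∫_{good} 1_E(Φ_a z₀) 1_{fast}(Φ_a z₀) |W(z₀)| dz₀`. [folklore] -/
theorem integral_event_fast_eq {N₀ : ℕ} (E Fa : Set (Config N₀ d (UnitAddTorus d))) (hE : MeasurableSet E) (hFa : MeasurableSet Fa)
    (hEg : E ⊆ Alexander.good (Torus.geometry d) ε)
    {W : Config N₀ d (UnitAddTorus d) → ℝ} (hW : Measurable W) (a : ℝ) :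
    ∫ z, E.indicator (1 : Config N₀ d (UnitAddTorus d) → ℝ) z * (Fa.indicator (1 : Config N₀ d (UnitAddTorus d) → ℝ) z *
        |W (Alexander.regFlow (Torus.geometry d) ε (-a) z)|) =
      ∫ z₀ in Alexander.good (Torus.geometry d) ε, E.indicator (1 : Config N₀ d (UnitAddTorus d) → ℝ) (Alexander.regFlow (Torus.geometry d) ε a z₀) *
        (Fa.indicator (1 : Config N₀ d (UnitAddTorus d) → ℝ) (Alexander.regFlow (Torus.geometry d) ε a z₀) * |W z₀|) := by
  set ΦN := Alexander.regHardSphereFlow (d := d) hε hε' N₀ with hΦN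
  have hgm : Measurable fun z : Config N₀ d (UnitAddTorus d) => E.indicator (1 : Config N₀ d (UnitAddTorus d) → ℝ) z *
      (Fa.indicator (1 : Config N₀ d (UnitAddTorus d) → ℝ) z * |W (Alexander.regFlow (Torus.geometry d) ε (-a) z)|) :=
    (measurable_const.indicator hE).mul ((measurable_const.indicator hFa).mul
      (continuous_abs.measurable.comp (hW.comp (Alexander.measurable_regFlow hε' _))))
  have key := ΦN.setIntegral_comp_flow a hgm
  simp only [hΦN, Alexander.regHardSphereFlow_flow, Alexander.regHardSphereFlow_good] at key
  rw [← setIntegral_eq_integral_of_forall_compl_eq_zero (s := Alexander.good (Torus.geometry d) ε) (fun z hz => by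
    rw [indicator_of_notMem (fun h => hz (hEg h)), zero_mul]), ← key]
  refine setIntegral_congr_fun (Alexander.measurableSet_good (Torus.isHardSphereRegular_geometry hε') Torus.isMeasurable_geometry) fun z₀ _ => ?_
  rw [← Alexander.regFlow_add hε hε', neg_add_cancel, Alexander.regFlow_zero hε hε']

end Fast


section Generic

variable {ε : ℝ} (hε : 0 < ε) (hε' : ε < 2⁻¹)

omit [Fintype d] in
/-- The tagged block of a loss configuration is the tagged block of its old spheres. [folklore] -/
theorem lossConfig_comp_castAdd_eq [Fintype d] {X : Type*} (G : Geometry d X) (ε : ℝ) {k m' : ℕ} (Z' : Config (k + m') d X)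
    (i' : Fin (k + m')) (ω v : EuclideanSpace ℝ d) :
    ((lossConfig G ε Z' i' ω v : Config (k + m' + 1) d X) ∘ Fin.castAdd (m' + 1) : Config k d X) =
      (Z' ∘ Fin.castAdd m' : Config k d X) := by
  funext j
  have : (Fin.castAdd (m' + 1) j : Fin (k + (m' + 1))) = (Fin.castAdd 1 (Fin.castAdd m' j) : Fin (k + m' + 1)) := Fin.ext rfl
  simp only [Function.comp_apply]
  rw [this, lossConfig_apply_castAdd]

omit [Fintype d] in
/-- The tagged block of a gain configuration whose partner is tagged: the partner carries the
pre-collisional velocity. [folklore] -/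
theorem gainConfig_comp_castAdd_eq [Fintype d] {X : Type*} (G : Geometry d X) (ε : ℝ) {k m' : ℕ} (Z' : Config (k + m') d X)
    (i : Fin k) (ω v : EuclideanSpace ℝ d) :
    ((gainConfig G ε Z' (Fin.castAdd m' i) ω v : Config (k + m' + 1) d X) ∘ Fin.castAdd (m' + 1) : Config k d X) =
      Function.update (Z' ∘ Fin.castAdd m' : Config k d X) i
        ((Z' (Fin.castAdd m' i)).1, (reflectVel ω ((Z' (Fin.castAdd m' i)).2, v)).1) := by
  funext j
  have hc : (Fin.castAdd (m' + 1) j : Fin (k + (m' + 1))) = (Fin.castAdd 1 (Fin.castAdd m' j) : Fin (k + m' + 1)) := Fin.ext rfl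
  simp only [Function.comp_apply]
  rw [hc]
  unfold gainConfig
  rw [appendParticle_castAdd]
  by_cases hj : j = i
  · subst hj
    rw [Function.update_self, Function.update_self]
  · have hne : (Fin.castAdd m' j : Fin (k + m')) ≠ Fin.castAdd m' i := fun h => hj (Fin.castAdd_injective _ _ h)
    rw [Function.update_of_ne hne, Function.update_of_ne hj, Function.comp_apply]

/-- **Cylinders over null sets of the tagged block are null** in the product with the velocity
factor (`volume_setOf_tagged_mem_eq_zero` for `Config (k + m') × E`). [folklore] -/
theorem volume_prod_setOf_tagged_mem_eq_zero {k m' : ℕ} {S : Set (Config k d (UnitAddTorus d) × EuclideanSpace ℝ d)}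
    (hS : MeasurableSet S) (hS0 : ((volume : Measure (Config k d (UnitAddTorus d))).prod (volume : Measure (EuclideanSpace ℝ d))) S = 0) :
    ((volume : Measure (Config (k + m') d (UnitAddTorus d))).prod (volume : Measure (EuclideanSpace ℝ d)))
      {q : Config (k + m') d (UnitAddTorus d) × EuclideanSpace ℝ d | ((q.1 ∘ Fin.castAdd m' : Config k d (UnitAddTorus d)), q.2) ∈ S} = 0 := by
  haveI : SigmaFinite (volume : Measure (UnitAddTorus d × EuclideanSpace ℝ d)) := inferInstance
  haveI : SigmaFinite (volume : Measure (Config k d (UnitAddTorus d))) := inferInstance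
  haveI : SigmaFinite (volume : Measure (Config m' d (UnitAddTorus d))) := inferInstance
  haveI : SigmaFinite (volume : Measure (Config (k + m') d (UnitAddTorus d))) := inferInstance
  -- `((Y, Zm), v) ↦ (append Y Zm, v)` and `((Y, Zm), v) ↦ ((Y, v), Zm)`
  set e₁ := MeasurableEquiv.prodCongr (appendMEquiv (UnitAddTorus d × EuclideanSpace ℝ d) k m') (MeasurableEquiv.refl (EuclideanSpace ℝ d))
    with he₁
  have hmp₁ : MeasurePreserving e₁ ((((volume : Measure (Config k d (UnitAddTorus d))).prod (volume : Measure (Config m' d (UnitAddTorus d)))).prod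
      (volume : Measure (EuclideanSpace ℝ d))))
      (((volume : Measure (Config (k + m') d (UnitAddTorus d))).prod (volume : Measure (EuclideanSpace ℝ d)))) :=
    (volume_preserving_appendMEquiv (UnitAddTorus d × EuclideanSpace ℝ d) k m').prod (MeasurePreserving.id _)
  have hT : MeasurableSet {q : Config (k + m') d (UnitAddTorus d) × EuclideanSpace ℝ d |
      ((q.1 ∘ Fin.castAdd m' : Config k d (UnitAddTorus d)), q.2) ∈ S} :=
    (((measurable_pi_lambda _ fun i => measurable_pi_apply _).comp measurable_fst).prodMk measurable_snd) hS
  rw [← hmp₁.measure_preimage hT.nullMeasurableSet]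
  have hpre : e₁ ⁻¹' {q : Config (k + m') d (UnitAddTorus d) × EuclideanSpace ℝ d | ((q.1 ∘ Fin.castAdd m' : Config k d (UnitAddTorus d)), q.2) ∈ S} =
      {r : (Config k d (UnitAddTorus d) × Config m' d (UnitAddTorus d)) × EuclideanSpace ℝ d | (r.1.1, r.2) ∈ S} := by
    ext ⟨⟨Y, Zm⟩, v⟩
    have hcoe : e₁ ((Y, Zm), v) = (Fin.append Y Zm, v) := by
      rw [he₁]
      show (appendMEquiv (UnitAddTorus d × EuclideanSpace ℝ d) k m' (Y, Zm), (MeasurableEquiv.refl (EuclideanSpace ℝ d)) v) = _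
      rw [appendMEquiv_apply]; rfl
    simp only [mem_preimage, mem_setOf_eq, hcoe]
    have : (Fin.append Y Zm ∘ Fin.castAdd m' : Config k d (UnitAddTorus d)) = Y := by funext i; simp
    rw [this]
  rw [hpre]
  -- Fubini: the sections in `Zm` are all of `Config m'`, those in `(Y, v)` lie in `S`
  have hmeasT : MeasurableSet {r : (Config k d (UnitAddTorus d) × Config m' d (UnitAddTorus d)) × EuclideanSpace ℝ d | (r.1.1, r.2) ∈ S} :=
    (measurable_fst.fst.prodMk measurable_snd) hS
  rw [Measure.prod_apply hmeasT]
  have hsec : ∀ r : Config k d (UnitAddTorus d) × Config m' d (UnitAddTorus d),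
      (volume : Measure (EuclideanSpace ℝ d)) (Prod.mk r ⁻¹' {r : (Config k d (UnitAddTorus d) × Config m' d (UnitAddTorus d)) × EuclideanSpace ℝ d |
        (r.1.1, r.2) ∈ S}) = (volume : Measure (EuclideanSpace ℝ d)) (Prod.mk r.1 ⁻¹' S) := by
    intro r; rfl
  simp_rw [hsec]
  have h0 : (fun Y : Config k d (UnitAddTorus d) => (volume : Measure (EuclideanSpace ℝ d)) (Prod.mk Y ⁻¹' S)) =ᵐ[volume] 0 :=
    Measure.measure_ae_null_of_prod_null hS0
  have h0' := (Measure.quasiMeasurePreserving_fst (μ := (volume : Measure (Config k d (UnitAddTorus d))))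
    (ν := (volume : Measure (Config m' d (UnitAddTorus d))))).ae_eq h0
  have h0'' : (fun x : Config k d (UnitAddTorus d) × Config m' d (UnitAddTorus d) => (volume : Measure (EuclideanSpace ℝ d)) (Prod.mk x.1 ⁻¹' S)) =ᵐ[
      (volume : Measure (Config k d (UnitAddTorus d))).prod (volume : Measure (Config m' d (UnitAddTorus d)))] 0 := h0'
  rw [lintegral_congr_ae h0'']
  simp


include hε hε' in
/-- **Almost every parameter has good tagged blocks**: for `vol ⊗ vol`-a.e. `(Z', v)` (old spheres
and outgoing velocity), the tagged block `π Z'`, the tagged block of the incoming configuration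
(the partner `i` carries the pre-collisional velocity) and its velocity flip are good as soon as
they lie in the hard-sphere domain (`volume_diff_good` for `k` spheres, cylinders over null sets,
the scattering bijection and the velocity flip preserve Lebesgue measure). [folklore] -/
theorem ae_taggedBlocks_good {k m' : ℕ} [NeZero k] (i : Fin k) (ν : sphere (0 : EuclideanSpace ℝ d) 1) :
    ∀ᵐ q : Config (k + m') d (UnitAddTorus d) × EuclideanSpace ℝ d ∂((volume : Measure (Config (k + m') d (UnitAddTorus d))).prod
        (volume : Measure (EuclideanSpace ℝ d))),
      ((q.1 ∘ Fin.castAdd m' : Config k d (UnitAddTorus d)) ∈ hardSphereDomain (Torus.geometry d) k ε →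
        (q.1 ∘ Fin.castAdd m' : Config k d (UnitAddTorus d)) ∈ Alexander.good (Torus.geometry d) ε) ∧
      (Function.update (q.1 ∘ Fin.castAdd m' : Config k d (UnitAddTorus d)) i
          ((q.1 (Fin.castAdd m' i)).1, (reflectVel (ν : EuclideanSpace ℝ d) ((q.1 (Fin.castAdd m' i)).2, q.2)).1) ∈
          hardSphereDomain (Torus.geometry d) k ε →
        Function.update (q.1 ∘ Fin.castAdd m' : Config k d (UnitAddTorus d)) i
          ((q.1 (Fin.castAdd m' i)).1, (reflectVel (ν : EuclideanSpace ℝ d) ((q.1 (Fin.castAdd m' i)).2, q.2)).1) ∈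
          Alexander.good (Torus.geometry d) ε) ∧
      (flipVel (Function.update (q.1 ∘ Fin.castAdd m' : Config k d (UnitAddTorus d)) i
          ((q.1 (Fin.castAdd m' i)).1, (reflectVel (ν : EuclideanSpace ℝ d) ((q.1 (Fin.castAdd m' i)).2, q.2)).1)) ∈
          hardSphereDomain (Torus.geometry d) k ε →
        flipVel (Function.update (q.1 ∘ Fin.castAdd m' : Config k d (UnitAddTorus d)) i
          ((q.1 (Fin.castAdd m' i)).1, (reflectVel (ν : EuclideanSpace ℝ d) ((q.1 (Fin.castAdd m' i)).2, q.2)).1)) ∈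
          Alexander.good (Torus.geometry d) ε) := by
  obtain ⟨k₀, rfl⟩ := Nat.exists_eq_succ_of_ne_zero (NeZero.ne k)
  haveI : SigmaFinite (volume : Measure (UnitAddTorus d × EuclideanSpace ℝ d)) := inferInstance
  haveI : SigmaFinite (volume : Measure (Config (k₀ + 1) d (UnitAddTorus d))) := inferInstance
  haveI : SigmaFinite (volume : Measure (Config k₀ d (UnitAddTorus d))) := inferInstance
  have hG := Torus.isHardSphereRegular_geometry (d := d) hε'
  have hGm := Torus.isMeasurable_geometry (d := d)
  set Φk := Alexander.regHardSphereFlow (d := d) hε hε' (k₀ + 1) with hΦk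
  set Nbad : Set (Config (k₀ + 1) d (UnitAddTorus d)) := hardSphereDomain (Torus.geometry d) (k₀ + 1) ε \ Alexander.good (Torus.geometry d) ε
    with hNbad
  have hNm : MeasurableSet Nbad :=
    (measurableSet_hardSphereDomain _ Torus.measurable_geometry_sepVec _ ε).diff (Alexander.measurableSet_good hG hGm)
  have hN0 : volume Nbad = 0 := by
    have := Φk.volume_diff_good
    simpa [hΦk] using this
  -- the tagged-level scattering map
  have hU : ∀ q : Config (k₀ + 1 + m') d (UnitAddTorus d) × EuclideanSpace ℝ d,
      Function.update (q.1 ∘ Fin.castAdd m' : Config (k₀ + 1) d (UnitAddTorus d)) i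
        ((q.1 (Fin.castAdd m' i)).1, (reflectVel (ν : EuclideanSpace ℝ d) ((q.1 (Fin.castAdd m' i)).2, q.2)).1) =
      (scatterParams i ν ((q.1 ∘ Fin.castAdd m' : Config (k₀ + 1) d (UnitAddTorus d)), q.2)).1 := by
    intro q
    simp only [scatterParams, Function.comp_apply, reflectVel_eq_collide]
  have hsPm : Measurable (scatterParams (X := UnitAddTorus d) i ν) := (measurePreserving_scatterParams (X := UnitAddTorus d) i ν).measurable
  -- the three null sets at the tagged level
  have hS1 : ((volume : Measure (Config (k₀ + 1) d (UnitAddTorus d))).prod (volume : Measure (EuclideanSpace ℝ d))) (Nbad ×ˢ (univ : Set (EuclideanSpace ℝ d))) = 0 := by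
    rw [Measure.prod_prod, hN0, zero_mul]
  have hS2 : ((volume : Measure (Config (k₀ + 1) d (UnitAddTorus d))).prod (volume : Measure (EuclideanSpace ℝ d)))
      ((scatterParams (X := UnitAddTorus d) i ν) ⁻¹' (Nbad ×ˢ (univ : Set (EuclideanSpace ℝ d)))) = 0 := by
    rw [(measurePreserving_scatterParams (X := UnitAddTorus d) i ν).measure_preimage (hNm.prod MeasurableSet.univ).nullMeasurableSet, hS1]
  have hflip0 : volume (flipVel ⁻¹' Nbad : Set (Config (k₀ + 1) d (UnitAddTorus d))) = 0 := by
    rw [(measurePreserving_flipVel (X := UnitAddTorus d) (N := k₀ + 1)).measure_preimage hNm.nullMeasurableSet, hN0]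
  have hS3 : ((volume : Measure (Config (k₀ + 1) d (UnitAddTorus d))).prod (volume : Measure (EuclideanSpace ℝ d)))
      ((scatterParams (X := UnitAddTorus d) i ν) ⁻¹' ((flipVel ⁻¹' Nbad) ×ˢ (univ : Set (EuclideanSpace ℝ d)))) = 0 := by
    rw [(measurePreserving_scatterParams (X := UnitAddTorus d) i ν).measure_preimage
      ((hNm.preimage measurable_flipVel).prod MeasurableSet.univ).nullMeasurableSet, Measure.prod_prod, hflip0, zero_mul]
  -- lift to the parameters
  have hT1 := volume_prod_setOf_tagged_mem_eq_zero (m' := m') (hNm.prod MeasurableSet.univ) hS1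
  have hT2 := volume_prod_setOf_tagged_mem_eq_zero (m' := m') ((hNm.prod MeasurableSet.univ).preimage hsPm) hS2
  have hT3 := volume_prod_setOf_tagged_mem_eq_zero (m' := m') (((hNm.preimage measurable_flipVel).prod MeasurableSet.univ).preimage hsPm) hS3
  rw [← compl_mem_ae_iff] at hT1 hT2 hT3
  filter_upwards [hT1, hT2, hT3] with q h1 h2 h3
  simp only [mem_compl_iff, mem_setOf_eq, mem_prod, mem_univ, and_true, mem_preimage] at h1 h2 h3
  refine ⟨fun hD => ?_, fun hD => ?_, fun hD => ?_⟩
  · by_contra hng; exact h1 ⟨hD, hng⟩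
  · by_contra hng; rw [hU] at hD hng; exact h2 ⟨hD, hng⟩
  · by_contra hng; rw [hU] at hD hng; exact h3 ⟨hD, hng⟩

end Generic


end Kinetic

end

end Literature.MathematicalPhysics.KineticTheory
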